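import Summits.ValiantsHypothesis.ValiantsHypothesis.Theorems.GrenetZeonDualUnipotentThreeHalvesLongMassBipartiteGraftPrice

/-!
# `GrenetZeon.DualUnipotentThreeHalves` (stmt-ValiantsHypothesis-24318), line `slow_core`, stub (c) `SlowCore.LongMassSlowLawInv`:
# THE SQUARE-ROOT TRANSFER — a bipartite pencil is at most `2n` dearer than its quadratic PRODUCT pencil

SHORT RINGS (two levels) are the regime where the cyclic row (✓ `…LongMassCyclicGrading`, cheap for MANY levels) is silent and where the only
inhabited fat ∧ long ∧ irreducible species lives (the graft, ✓ `…BipartiteGraft*`).  The graft was priced by an ad-hoc ledger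
(✓ `BipartiteGraft.ledger_graft`).  This file isolates the general mechanism behind it: for EVERY bipartite pencil
`G = [[0, Q], [P, 0]]` (`Q : u × u'`, `P : u' × u` affine blocks) the powers are the powers of the quadratic PRODUCT PENCIL `Q·P` (`u × u`,
entries of degree `≤ 2`) dressed by at most one `P` on the left and one `Q` on the right (✓ `bipartite_pow_even/odd`, `pow_succ_sandwich`,
`pow_mul_shift`), so every window certificate of `Q·P` is one of `G` at two more units of window:

* ★★ `ledger_bipartite` — `Ledger n u (Q·P) ⊤ K k → Ledger n m G ⊤ K (k + 2)` (same direction space `K`).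
* ★★★ `relCert_bipartite` — THE SQUARE-ROOT TRANSFER: `RelCert n u (Q·P) P₀ → RelCert n m G (P₀ + 2n)`.  (`SlowCore.Ledger`/`RelCert` never use
  affineness, so they price the quadratic pencil `Q·P` verbatim.)
* Reading for (c): the price of a two-level ring is, up to `2n`, the price of the `u × u` product pencil `x ↦ Q(x)P(x)` — a QUADRATIC nil pencil
  on the smaller space (nilpotent iff `G` is, ✓ bipartite square-root criterion).  For the graft `Q·P = −s·N` (✓ `graft_QP`), whence its
  price-neutrality.  So the (c)-question on short rings is EXACTLY the window question for quadratic nil pencils `Q(x)P(x)` whose polarisation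
  `Q(x)P(y) + Q(y)P(x)` is unconstrained — the honest residual object behind «≥ 2 independent fat letter-spaces» (violator portrait).

HONEST FRAMING.  Transfer lemma (`--supports stmt-ValiantsHypothesis-24318`); not progress on the research stub (c) `SlowCore.LongMassSlowLawInv`;
closes no stub; S3, 24318, 8062 and `VP ≠ VNP` are NOT proved.  Def-free, no named-fact hypotheses, no sorry. [folklore]
-/

set_option linter.dupNamespace false
set_option autoImplicit false

noncomputable section

namespace Summit.ValiantsHypothesis.ValiantsHypothesis.Theorems.GrenetZeon.BipartiteGraft

open MvPolynomial Matrix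
open scoped BigOperators
open Summit.ValiantsHypothesis.ValiantsHypothesis.Cruxes.TwoDimCoefficients.DimTwoCases (AffMat IsAffine)
open Summit.ValiantsHypothesis.ValiantsHypothesis.Theorems.GrenetZeon.RadicalSplit (lineSubst)
open Summit.ValiantsHypothesis.ValiantsHypothesis.Theorems.GrenetZeon.SlowCore (Ledger RelCert)
open Summit.ValiantsHypothesis.ValiantsHypothesis.Theorems.GrenetZeon.GaugeRow (totalDegree_lineSubst_le_one)

section Transfer

variable {n u u' m : ℕ} (e : Fin u ⊕ Fin u' ≃ Fin m)
  (Qp : Matrix (Fin u) (Fin u') (MvPolynomial (Fin n × Fin n) ℂ)) (Pp : Matrix (Fin u') (Fin u) (MvPolynomial (Fin n × Fin n) ℂ))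

/-- Degree bookkeeping for the powers of a bipartite matrix over `ℂ[s]`: if `Q`, `P` have entries of degree `≤ 1` and every power `(QP)^j`,
`j ≤ J`, has entries of degree `≤ k`, then every power `[[0,Q],[P,0]]^b`, `b ≤ 2J + 1`, has entries of degree `≤ k + 2`. -/
theorem deg_bipartite_pow_le {Q : Matrix (Fin u) (Fin u') (MvPolynomial (Fin 1) ℂ)} {P : Matrix (Fin u') (Fin u) (MvPolynomial (Fin 1) ℂ)}
    (hQ : ∀ i j, (Q i j).totalDegree ≤ 1) (hP : ∀ i j, (P i j).totalDegree ≤ 1) {k J : ℕ}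
    (hk : ∀ j, j ≤ J → ∀ a c, (((Q * P) ^ j) a c).totalDegree ≤ k) {b : ℕ} (hb : b ≤ 2 * J + 1) :
    ∀ i j, (((fromBlocks 0 Q P 0) ^ b) i j).totalDegree ≤ k + 2 := by
  obtain ⟨j, rfl | rfl⟩ := Nat.even_or_odd' b
  · -- even power `2j`: blocks `(QP)^j` and `(PQ)^j`
    have hj : j ≤ J := by omega
    rw [bipartite_pow_even]
    refine deg_fromBlocks_le (fun a c => (hk j hj a c).trans (by omega)) (deg_zero_le _) (deg_zero_le _) ?_
    rcases Nat.eq_zero_or_pos j with hj0 | hj0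
    · subst hj0
      intro a c
      rw [pow_zero]
      exact deg_one_le _ a c
    · obtain ⟨j', rfl⟩ : ∃ j', j = j' + 1 := ⟨j - 1, by omega⟩
      rw [pow_succ_sandwich]
      intro a c
      have h := deg_mul_le (deg_mul_le hP (hk j' (by omega))) hQ a c
      omega
  · -- odd power `2j+1`: blocks `(QP)^j Q` and `(PQ)^j P = P (QP)^j`
    have hj : j ≤ J := by omega
    rw [bipartite_pow_odd, pow_mul_shift Q P j]
    refine deg_fromBlocks_le (deg_zero_le _) ?_ ?_ (deg_zero_le _)
    · intro a c
      have h := deg_mul_le (hk j hj) hQ a c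
      omega
    · intro a c
      have h := deg_mul_le hP (hk j hj) a c
      omega

/-- ★★ **LEDGER TRANSFER.**  A whole-pencil window ledger `(K, k)` of the PRODUCT pencil `Q·P` is a ledger `(K, k + 2)` of the bipartite pencil
`[[0, Q], [P, 0]]` (affine blocks). [folklore] -/
theorem ledger_bipartite (hQ : ∀ i j, (Qp i j).totalDegree ≤ 1) (hP : ∀ i j, (Pp i j).totalDegree ≤ 1)
    {K : Submodule ℂ (Fin n × Fin n → ℂ)} {k : ℕ} (hL : Ledger n u (Qp * Pp) (fun _ => True) K k)
    (G : AffMat n m) (hG : G = Matrix.reindex e e (fromBlocks 0 Qp Pp 0)) :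
    Ledger n m G (fun _ => True) K (k + 2) := by
  intro x v hv b hb i j _ _
  rw [hG, Matrix.reindex_apply, ← Matrix.submatrix_map, fromBlocks_map, Matrix.map_zero _ (map_zero _),
    Matrix.map_zero _ (map_zero _), ← Matrix.reindex_apply, reindex_pow, Matrix.reindex_apply, Matrix.submatrix_apply]
  have hprod : ∀ j', j' ≤ n - 1 → ∀ a c, (((Qp.map (lineSubst x v) * Pp.map (lineSubst x v)) ^ j') a c).totalDegree ≤ k := by
    intro j' hj' a c
    have h := hL x v hv j' hj' a c trivial trivial
    rwa [Matrix.map_mul] at h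
  refine deg_bipartite_pow_le (fun a c => ?_) (fun a c => ?_) (J := n - 1) hprod (by omega) _ _
  · rw [Matrix.map_apply]; exact totalDegree_lineSubst_le_one x v (hQ a c)
  · rw [Matrix.map_apply]; exact totalDegree_lineSubst_le_one x v (hP a c)

/-- ★★★ **THE SQUARE-ROOT TRANSFER.**  `RelCert n u (Q·P) P₀ → RelCert n m [[0,Q],[P,0]] (P₀ + 2n)`: a two-level ring is at most `2n` dearer
than its quadratic product pencil on the smaller space. [folklore] -/
theorem relCert_bipartite (hQ : ∀ i j, (Qp i j).totalDegree ≤ 1) (hP : ∀ i j, (Pp i j).totalDegree ≤ 1) {P₀ : ℕ}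
    (hR : RelCert n u (Qp * Pp) P₀) (G : AffMat n m) (hG : G = Matrix.reindex e e (fromBlocks 0 Qp Pp 0)) :
    RelCert n m G (P₀ + 2 * n) := by
  obtain ⟨K, k, hL, hprice⟩ := hR
  refine ⟨K, k + 2, ledger_bipartite e Qp Pp hQ hP hL G hG, ?_⟩
  have e1 : n * (k + 2) = n * k + 2 * n := by ring
  rw [e1]
  omega

/-- The transposed reading: `[[0,Q],[P,0]]` is also at most `2n` dearer than the OTHER product pencil `P·Q` (`u' × u'`), by the symmetric
re-indexing `Fin u' ⊕ Fin u ≃ Fin m`. [folklore] -/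
theorem relCert_bipartite' (e' : Fin u' ⊕ Fin u ≃ Fin m) (hQ : ∀ i j, (Qp i j).totalDegree ≤ 1) (hP : ∀ i j, (Pp i j).totalDegree ≤ 1)
    {P₀ : ℕ} (hR : RelCert n u' (Pp * Qp) P₀) (G : AffMat n m) (hG : G = Matrix.reindex e' e' (fromBlocks 0 Pp Qp 0)) :
    RelCert n m G (P₀ + 2 * n) :=
  relCert_bipartite e' Pp Qp hP hQ hR G hG

end Transfer

end Summit.ValiantsHypothesis.ValiantsHypothesis.Theorems.GrenetZeon.BipartiteGraft

end
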